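import Summits.ValiantsHypothesis.ValiantsHypothesis.Theorems.KPlusLogSqLawTropicalBParityLaw
import Summits.ValiantsHypothesis.ValiantsHypothesis.Theorems.KPlusLogSqLawTropicalBMultiExchange
import Summits.ValiantsHypothesis.ValiantsHypothesis.Theorems.LacunarySymmetroidMatrixDescartesCensusTropicalKLawStatic

/-!
# Route «KPlusLogSqLaw», crux `TropicalB` (stmt-ValiantsHypothesis-19771) — LEX-NT, part 3a: pairwise laws of the lex core and the
# LATIN-TRIPLE CLOSURE (three slot transversals ⇒ contradiction by the multi-exchange law)

HONEST FRAMING.  Structure lemmas for dominance designs of ANY format (any `m`, `K`, valuations, signs), toward the crux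
`Summit.ValiantsHypothesis.ValiantsHypothesis.Theses.KPlusLogSqLaw.TropicalB` (item stmt-ValiantsHypothesis-19771, route KPlusLogSqLaw;
cell `pub-symmetroid`, seat val-sym-trop-p5 g14, 2026-08-28; `--supports … --as helper`); they assemble in part 3b
(`…TropicalBLexCoreLaw`, `lex_core_law`) into the all-`m` law LEX-NT conjectured by g13.  Nothing here bears on `TropicalB` in its window,
`WeakLifting`, DoorA26 / DoorA34, `MatrixDescartes` (stmt-ValiantsHypothesis-18050) or VP ≠ VNP.

CONTENT.
* `noT_AC`, `rho_fixed` — for dominant `A = (α, all c₂)` before `C = (γ, c₀ off {x, y}, c₂ at y, anything at x)` with `d c₀ < d c₂` and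
  `m ≥ 3`: every fixed column of `α⁻¹γ` is `y` (cyclewise exchange law `sum_d_lt_of_isDominant_invariant` on `{b}` and on the cycle of a
  third column).
* `coincidence` — for dominant `B = (β, classes of exponent > d c₀)` before `C = (γ, c₀ off {x, y})`: `β b = γ b` only at `b ∈ {x, y}`.
* `add_add_le_sum`, `sum_eq_add_add`, `perm3_sum`, `card_filter_range_three` — bookkeeping.
* `latin_contra` — **LATIN-TRIPLE CLOSURE**: three unique optima `T 0 ≺ T 1 ≺ T 2` and three slot transversals `s₀, s₁, s₂ : Fin m → Fin 3`
  (pointwise pairwise distinct, each with injective row map) with `s₀`'s term `≠ T 0` in some row, column-wise class-dominated by `T 0`,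
  and `S(T 2) ≤ S(s₂'s term)` — impossible (`MultiExchange.prefix_deficit`, `t = 3`: the transversal terms are present and repackage the
  three terms column by column).
[this cell; the exchange laws are the tree's (conjb-2 g4 / val-sym-trop-p4)]
-/

set_option linter.dupNamespace false
set_option autoImplicit false

namespace Summit.ValiantsHypothesis.ValiantsHypothesis.Theorems.KPlusLogSqLaw

namespace LexCore

open Summit.ValiantsHypothesis.ValiantsHypothesis.Theorems.MatrixDescartes.Negative
open Finset

variable {m K : ℕ}

/-! ## 1. Pairwise laws: fixed columns of `α⁻¹γ`, coincidences of `β` and `γ` -/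

/-- no invariant column set of `α⁻¹γ` avoiding `x` on which `A` (all `c₂`) and `C` (classes `≤ c₂` off `x`) differ. [this cell] -/
theorem noT_AC (d : Fin K → ℕ) (v ε : Fin m → Fin m → Fin K → ℤ) {θA θC : ℤ} (hAC : θA < θC)
    {α γ : Equiv.Perm (Fin m)} {lA lC : Fin m → Fin K} (hA : IsDominant d v ε θA (α, lA)) (hC : IsDominant d v ε θC (γ, lC))
    (x : Fin m) (hle : ∀ b, b ≠ x → d (lC b) ≤ d (lA b))
    (T : Finset (Fin m)) (hT : ∀ b, (α⁻¹ * γ) b ∈ T ↔ b ∈ T) (hx : x ∉ T) (hne : ∃ b ∈ T, α b ≠ γ b ∨ lA b ≠ lC b) : False := by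
  have hlaw := sum_d_lt_of_isDominant_invariant d v ε hAC hA hC T hT hne
  have hge : ∑ b ∈ T, (d (lC b) : ℤ) ≤ ∑ b ∈ T, (d (lA b) : ℤ) :=
    Finset.sum_le_sum fun b hb => by exact_mod_cast hle b (fun h => hx (h ▸ hb))
  exact absurd hlaw (not_lt.mpr hge)

/-- **fixed columns of `ρ = α⁻¹γ` lie in `{y}`** (`m ≥ 3`): `A = (α, all c₂)`, `C = (γ, c₀ off {x, y}, c₂ at y)`, `d c₀ < d c₂`,
`d (lC x)` arbitrary. [this cell] -/
theorem rho_fixed (hm : 3 ≤ m) (d : Fin K → ℕ) (v ε : Fin m → Fin m → Fin K → ℤ) {θA θC : ℤ} (hAC : θA < θC)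
    {α γ : Equiv.Perm (Fin m)} {lA lC : Fin m → Fin K} (hA : IsDominant d v ε θA (α, lA)) (hC : IsDominant d v ε θC (γ, lC))
    (c₀ c₂ : Fin K) (h02 : d c₀ < d c₂) (x y : Fin m) (hlA : ∀ b, lA b = c₂) (hlC : ∀ b, b ≠ x → b ≠ y → lC b = c₀)
    (hy : lC y = c₂) (b : Fin m) (hb : (α⁻¹ * γ) b = b) : b = y := by
  classical
  have hle : ∀ b, b ≠ x → d (lC b) ≤ d (lA b) := by
    intro b hbx
    rw [hlA b]
    by_cases hby : b = y
    · rw [hby, hy]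
    · rw [hlC b hbx hby]; exact h02.le
  -- (a) a fixed column other than `x`, `y` is impossible
  have step : ∀ b, b ≠ x → b ≠ y → (α⁻¹ * γ) b ≠ b := by
    intro b hbx hby hfb
    refine noT_AC d v ε hAC hA hC x hle {b} (fun c => ?_) (by simpa using fun h => hbx h.symm)
      ⟨b, Finset.mem_singleton_self b, Or.inr ?_⟩
    · simp only [Finset.mem_singleton]
      constructor
      · intro h; exact (α⁻¹ * γ).injective (h.trans hfb.symm)
      · intro h; rw [h, hfb]
    · rw [hlA b, hlC b hbx hby]; intro h; rw [h] at h02; exact lt_irrefl _ h02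
  by_contra hby
  have hbx : b = x := by
    by_contra hbx
    exact step b hbx hby hb
  subst hbx
  -- (b) `x` fixed: the cycle of a third column avoids `x`
  obtain ⟨c, hcx, hcy⟩ : ∃ c : Fin m, c ≠ b ∧ c ≠ y := by
    have hcard : 2 < (univ : Finset (Fin m)).card := by rw [Finset.card_univ, Fintype.card_fin]; omega
    rw [Finset.two_lt_card_iff] at hcard
    obtain ⟨p, q, r, -, -, -, hpq, hpr, hqr⟩ := hcard
    by_cases hp : p ≠ b ∧ p ≠ y
    · exact ⟨p, hp.1, hp.2⟩
    by_cases hq : q ≠ b ∧ q ≠ y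
    · exact ⟨q, hq.1, hq.2⟩
    refine ⟨r, fun h => ?_, fun h => ?_⟩
    · rw [not_and_or, not_not, not_not] at hp hq
      rcases hp with hp | hp <;> rcases hq with hq | hq
      · exact hpq (hp.trans hq.symm)
      · exact hpr (hp.trans h.symm)
      · exact hqr (hq.trans h.symm)
      · exact hpq (hp.trans hq.symm)
    · rw [not_and_or, not_not, not_not] at hp hq
      rcases hp with hp | hp <;> rcases hq with hq | hq
      · exact hpq (hp.trans hq.symm)
      · exact hqr (hq.trans h.symm)
      · exact hpr (hp.trans h.symm)
      · exact hpq (hp.trans hq.symm)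
  set ρ := α⁻¹ * γ with hρ
  refine noT_AC d v ε hAC hA hC b hle (univ.filter fun z => ρ.SameCycle c z) (fun z => ?_) ?_ ⟨c, ?_, Or.inr ?_⟩
  · simp only [Finset.mem_filter, Finset.mem_univ, true_and]
    exact Equiv.Perm.sameCycle_apply_right
  · simp only [Finset.mem_filter, Finset.mem_univ, true_and]
    intro h
    exact hcx (h.eq_of_right hb)
  · simp only [Finset.mem_filter, Finset.mem_univ, true_and]
    exact Equiv.Perm.SameCycle.refl _ _
  · rw [hlA c, hlC c hcx hcy]; intro h; rw [h] at h02; exact lt_irrefl _ h02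

/-- **coincidences `β b = γ b` lie in `{x, y}`**: `B = (β, classes of exponent > d c₀)`, `C = (γ, c₀ off {x, y})`. [this cell] -/
theorem coincidence (d : Fin K → ℕ) (v ε : Fin m → Fin m → Fin K → ℤ) {θB θC : ℤ} (hBC : θB < θC)
    {β γ : Equiv.Perm (Fin m)} {lB lC : Fin m → Fin K} (hB : IsDominant d v ε θB (β, lB)) (hC : IsDominant d v ε θC (γ, lC))
    (c₀ : Fin K) (x y : Fin m) (hlB : ∀ b, d c₀ < d (lB b)) (hlC : ∀ b, b ≠ x → b ≠ y → lC b = c₀)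
    (b : Fin m) (hb : β b = γ b) : b = x ∨ b = y := by
  classical
  by_contra h
  rw [not_or] at h
  have hfix : (β⁻¹ * γ) b = b := by
    rw [Equiv.Perm.mul_apply, Equiv.Perm.inv_eq_iff_eq]; exact hb.symm
  have hlaw := sum_d_lt_of_isDominant_invariant d v ε hBC hB hC {b} (fun c => ?_) ⟨b, Finset.mem_singleton_self b, Or.inr ?_⟩
  · simp only [Finset.sum_singleton] at hlaw
    rw [hlC b h.1 h.2] at hlaw
    exact absurd hlaw (not_lt.mpr (by exact_mod_cast (hlB b).le))
  · simp only [Finset.mem_singleton]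
    constructor
    · intro hc; exact (β⁻¹ * γ).injective (hc.trans hfix.symm)
    · intro hc; rw [hc, hfix]
  · rw [hlC b h.1 h.2]; intro hc; have := hlB b; rw [hc] at this; exact lt_irrefl _ this

/-! ## 2. Bookkeeping: sums with two special columns, three-slot counts -/

/-- a sum over `Fin m` with two distinguished columns bounded below. [folklore] -/
theorem add_add_le_sum (g : Fin m → ℤ) (L u₁ u₂ : ℤ) (b₁ b₂ : Fin m) (hne : b₁ ≠ b₂) (hL : ∀ b, L ≤ g b)
    (h1 : u₁ ≤ g b₁) (h2 : u₂ ≤ g b₂) : u₁ + u₂ + ((m : ℤ) - 2) * L ≤ ∑ b, g b := by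
  classical
  have hb2 : b₂ ∈ (univ : Finset (Fin m)).erase b₁ := Finset.mem_erase.mpr ⟨hne.symm, Finset.mem_univ _⟩
  rw [← Finset.add_sum_erase _ _ (Finset.mem_univ b₁), ← Finset.add_sum_erase _ _ hb2]
  have hcard : (((univ : Finset (Fin m)).erase b₁).erase b₂).card = m - 2 := by
    rw [Finset.card_erase_of_mem hb2, Finset.card_erase_of_mem (Finset.mem_univ _), Finset.card_univ, Fintype.card_fin]
    omega
  have hm : 2 ≤ m := by
    have h1 := Finset.card_pos.mpr ⟨b₂, hb2⟩
    rw [Finset.card_erase_of_mem (Finset.mem_univ _), Finset.card_univ, Fintype.card_fin] at h1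
    omega
  have h3 : (((univ : Finset (Fin m)).erase b₁).erase b₂).card • L ≤ ∑ b ∈ ((univ : Finset (Fin m)).erase b₁).erase b₂, g b :=
    Finset.card_nsmul_le_sum _ _ _ fun b _ => hL b
  rw [hcard, nsmul_eq_mul] at h3
  have hm2 : ((m - 2 : ℕ) : ℤ) = (m : ℤ) - 2 := by omega
  rw [hm2] at h3
  linarith

/-- a sum over `Fin m` constant off two distinguished columns. [folklore] -/
theorem sum_eq_add_add (g : Fin m → ℤ) (L : ℤ) (b₁ b₂ : Fin m) (hne : b₁ ≠ b₂) (hL : ∀ b, b ≠ b₁ → b ≠ b₂ → g b = L) :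
    ∑ b, g b = g b₁ + g b₂ + ((m : ℤ) - 2) * L := by
  classical
  have hb2 : b₂ ∈ (univ : Finset (Fin m)).erase b₁ := Finset.mem_erase.mpr ⟨hne.symm, Finset.mem_univ _⟩
  rw [← Finset.add_sum_erase _ _ (Finset.mem_univ b₁), ← Finset.add_sum_erase _ _ hb2]
  have hcard : (((univ : Finset (Fin m)).erase b₁).erase b₂).card = m - 2 := by
    rw [Finset.card_erase_of_mem hb2, Finset.card_erase_of_mem (Finset.mem_univ _), Finset.card_univ, Fintype.card_fin]
    omega
  have hm : 2 ≤ m := by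
    have h1 := Finset.card_pos.mpr ⟨b₂, hb2⟩
    rw [Finset.card_erase_of_mem (Finset.mem_univ _), Finset.card_univ, Fintype.card_fin] at h1
    omega
  have h3 : ∑ b ∈ ((univ : Finset (Fin m)).erase b₁).erase b₂, g b = ∑ b ∈ ((univ : Finset (Fin m)).erase b₁).erase b₂, L := by
    refine Finset.sum_congr rfl fun b hb => ?_
    obtain ⟨hb2', hb1'⟩ := Finset.mem_erase.mp hb
    exact hL b (Finset.mem_erase.mp hb1').1 hb2'
  rw [h3, Finset.sum_const, hcard, nsmul_eq_mul]
  have hm2 : ((m - 2 : ℕ) : ℤ) = (m : ℤ) - 2 := by omega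
  rw [hm2]
  ring

/-- a sum over three pairwise distinct slots is the sum over all slots. [folklore] -/
theorem perm3_sum (g : Fin 3 → ℕ) (a b c : Fin 3) (hab : a ≠ b) (hac : a ≠ c) (hbc : b ≠ c) :
    g a + g b + g c = g 0 + g 1 + g 2 := by
  fin_cases a <;> fin_cases b <;> fin_cases c <;> simp at hab hac hbc ⊢ <;> omega

/-- the count of a value among three listed ones. [folklore] -/
theorem card_filter_range_three {X : Type*} [DecidableEq X] (F : ℕ → X) (a : X) :
    ((range 3).filter fun j => F j = a).card = (if F 0 = a then 1 else 0) + (if F 1 = a then 1 else 0) + (if F 2 = a then 1 else 0) := by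
  rw [Finset.card_filter, Finset.sum_range_succ, Finset.sum_range_succ, Finset.sum_range_succ, Finset.sum_range_zero, zero_add]

/-! ## 3. The Latin triple closes -/

/-- **LATIN TRIPLE ⇒ CONTRADICTION.**  Three unique optima `T 0 ≺ T 1 ≺ T 2` (slopes `θ 0 < θ 1 < θ 2`), and three slot transversals
`s₀, s₁, s₂` (pointwise pairwise distinct, each with injective row map — a Latin recolouring of the `3`-regular multigraph of the
three terms) such that `s₀`'s term differs from `T 0` in some row, is column-wise class-dominated by `T 0`, and `s₂`'s term has total
exponent `≥` that of `T 2`.  Impossible, by `MultiExchange.prefix_deficit` with `t = 3`. [this cell] -/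
theorem latin_contra (d : Fin K → ℕ) (v ε : Fin m → Fin m → Fin K → ℤ) (T : Fin 3 → Equiv.Perm (Fin m) × (Fin m → Fin K))
    (θ3 : Fin 3 → ℤ) (h01 : θ3 0 < θ3 1) (h12 : θ3 1 < θ3 2) (hdom : ∀ k, IsDominant d v ε (θ3 k) (T k))
    (s₀ s₁ s₂ : Fin m → Fin 3) (hd01 : ∀ b, s₀ b ≠ s₁ b) (hd02 : ∀ b, s₀ b ≠ s₂ b) (hd12 : ∀ b, s₁ b ≠ s₂ b)
    (hi₀ : Function.Injective fun b => (T (s₀ b)).1 b) (hi₁ : Function.Injective fun b => (T (s₁ b)).1 b)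
    (hi₂ : Function.Injective fun b => (T (s₂ b)).1 b)
    (hne : ∃ b, (T (s₀ b)).1 b ≠ (T 0).1 b) (hP1 : ∀ b, d ((T (s₀ b)).2 b) ≤ d ((T 0).2 b))
    (hP2 : ∑ b, (d ((T 2).2 b) : ℤ) ≤ ∑ b, (d ((T (s₂ b)).2 b) : ℤ)) : False := by
  classical
  -- the three transversal terms
  set Q₀ : Equiv.Perm (Fin m) × (Fin m → Fin K) :=
    (Equiv.ofBijective _ (Finite.injective_iff_bijective.mp hi₀), fun b => (T (s₀ b)).2 b) with hQ₀
  set Q₁ : Equiv.Perm (Fin m) × (Fin m → Fin K) :=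
    (Equiv.ofBijective _ (Finite.injective_iff_bijective.mp hi₁), fun b => (T (s₁ b)).2 b) with hQ₁
  set Q₂ : Equiv.Perm (Fin m) × (Fin m → Fin K) :=
    (Equiv.ofBijective _ (Finite.injective_iff_bijective.mp hi₂), fun b => (T (s₂ b)).2 b) with hQ₂
  have hQ₀1 : ∀ b, Q₀.1 b = (T (s₀ b)).1 b := fun b => by rw [hQ₀, Equiv.ofBijective_apply]
  have hQ₁1 : ∀ b, Q₁.1 b = (T (s₁ b)).1 b := fun b => by rw [hQ₁, Equiv.ofBijective_apply]
  have hQ₂1 : ∀ b, Q₂.1 b = (T (s₂ b)).1 b := fun b => by rw [hQ₂, Equiv.ofBijective_apply]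
  have hQ₀2 : ∀ b, Q₀.2 b = (T (s₀ b)).2 b := fun b => rfl
  have hQ₁2 : ∀ b, Q₁.2 b = (T (s₁ b)).2 b := fun b => rfl
  have hQ₂2 : ∀ b, Q₂.2 b = (T (s₂ b)).2 b := fun b => rfl
  -- ℕ-indexed families
  set P : ℕ → Equiv.Perm (Fin m) × (Fin m → Fin K) := fun j => if j = 0 then T 0 else if j = 1 then T 1 else T 2 with hP
  set Q : ℕ → Equiv.Perm (Fin m) × (Fin m → Fin K) := fun j => if j = 0 then Q₀ else if j = 1 then Q₁ else Q₂ with hQ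
  set θ : ℕ → ℤ := fun j => if j = 0 then θ3 0 else if j = 1 then θ3 1 else θ3 2 with hθ
  have P0 : P 0 = T 0 := by simp [hP]
  have P1 : P 1 = T 1 := by simp [hP]
  have P2 : P 2 = T 2 := by simp [hP]
  have Q0 : Q 0 = Q₀ := by simp [hQ]
  have Q1 : Q 1 = Q₁ := by simp [hQ]
  have Q2 : Q 2 = Q₂ := by simp [hQ]
  -- hypotheses of the multi-exchange law
  have hθ' : ∀ i, i + 1 < 3 → θ i ≤ θ (i + 1) := by
    intro i hi
    have : i = 0 ∨ i = 1 := by omega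
    rcases this with rfl | rfl
    · simp [hθ]; exact h01.le
    · simp [hθ]; exact h12.le
  have hdom' : ∀ j, j < 3 → IsDominant d v ε (θ j) (P j) := by
    intro j hj
    have : j = 0 ∨ j = 1 ∨ j = 2 := by omega
    rcases this with rfl | rfl | rfl
    · simp [hθ, hP]; exact hdom 0
    · simp [hθ, hP]; exact hdom 1
    · simp [hθ, hP]; exact hdom 2
  -- presence of the transversal terms
  have pres : ∀ (s : Fin m → Fin 3) (q : Equiv.Perm (Fin m) × (Fin m → Fin K)),
      (∀ b, q.1 b = (T (s b)).1 b) → (∀ b, q.2 b = (T (s b)).2 b) → termSign ε q ≠ 0 := by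
    intro s q h1 h2
    have e : q = (q.1, q.2) := rfl
    rw [e]
    unfold termSign
    refine mul_ne_zero (Units.ne_zero _) (Finset.prod_ne_zero_iff.mpr fun b _ => ?_)
    simp only
    rw [h1 b, h2 b]
    exact LacunarySymmetroidMatrixDescartes.TropicalCensus.present_of_termSign_ne_zero ε (T (s b)) (hdom (s b)).1 b
  have hQpres : ∀ j, j < 3 → termSign ε (Q j) ≠ 0 := by
    intro j hj
    have : j = 0 ∨ j = 1 ∨ j = 2 := by omega
    rcases this with rfl | rfl | rfl
    · rw [Q0]; exact pres s₀ Q₀ hQ₀1 hQ₀2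
    · rw [Q1]; exact pres s₁ Q₁ hQ₁1 hQ₁2
    · rw [Q2]; exact pres s₂ Q₂ hQ₂1 hQ₂2
  -- `Q₀ ≠ T 0`
  have hne' : ∃ j, j < 3 ∧ Q j ≠ P j := by
    obtain ⟨b, hb⟩ := hne
    refine ⟨0, by omega, fun h => hb ?_⟩
    rw [Q0, P0] at h
    rw [← hQ₀1 b, h]
  -- incidence counts agree column by column
  have hinc : ∀ (b : Fin m) (al : Fin m × Fin K),
      ((range 3).filter fun j => ((P j).1 b, (P j).2 b) = al).card =
        ((range 3).filter fun j => ((Q j).1 b, (Q j).2 b) = al).card := by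
    intro b al
    rw [card_filter_range_three (fun j => ((P j).1 b, (P j).2 b)) al, card_filter_range_three (fun j => ((Q j).1 b, (Q j).2 b)) al]
    simp only [P0, P1, P2, Q0, Q1, Q2, hQ₀1, hQ₁1, hQ₂1, hQ₀2, hQ₁2, hQ₂2]
    have key := perm3_sum (fun s => if (((T s).1 b, (T s).2 b) : Fin m × Fin K) = al then 1 else 0) (s₀ b) (s₁ b) (s₂ b)
      (hd01 b) (hd02 b) (hd12 b)
    omega
  -- the multi-exchange law
  obtain ⟨j, hj, hlt⟩ := MultiExchange.prefix_deficit d v ε 3 θ P Q hθ' hdom' hQpres hne' hinc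
  have hS := MultiExchange.sum_sum_eq_of_count_eq 3 P Q hinc fun _ al => (d al.2 : ℤ)
  simp only [Finset.sum_range_succ, Finset.sum_range_zero, zero_add, P0, P1, P2, Q0, Q1, Q2] at hS
  have hj' : j = 0 ∨ j = 1 := by omega
  rcases hj' with rfl | rfl
  · -- prefix of length one: `S(T 0) < S(Q₀)`, against the column-wise domination
    simp only [zero_add, Finset.sum_range_one, P0, Q0] at hlt
    have hge : ∑ b, (d (Q₀.2 b) : ℤ) ≤ ∑ b, (d ((T 0).2 b) : ℤ) :=
      Finset.sum_le_sum fun b _ => by rw [hQ₀2 b]; exact_mod_cast hP1 b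
    exact absurd hlt (not_lt.mpr hge)
  · -- prefix of length two: `S(Q₂) < S(T 2)`, against `hP2`
    simp only [Finset.sum_range_succ, Finset.sum_range_zero, zero_add, P0, P1, Q0, Q1] at hlt
    have hQ2sum : ∑ b, (d (Q₂.2 b) : ℤ) = ∑ b, (d ((T (s₂ b)).2 b) : ℤ) := Finset.sum_congr rfl fun b _ => by rw [hQ₂2 b]
    linarith

end LexCore

end Summit.ValiantsHypothesis.ValiantsHypothesis.Theorems.KPlusLogSqLaw
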